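import Literature.NumberTheory.GaloisCohomology.Howard2004.SelmerAScalarStabilityProofs
import HarnessLib

/-!
# Howard's Theorem 1.6.1 (ii)/(iii) in honest-module currency: the additive `Φ : H¹_F(K, A) ≃ 𝒟 ⊕ M ⊕ M`
# is `R`-semilinear for the levelwise scalar action — proofs file

Topic `NumberTheory/GaloisCohomology/Howard2004` (sequel to `SelmerAScalarStabilityProofs` and `DVRKolyvaginBound`).
THEOREMS ONLY: no definition, no named fact, no instance, no `sorry`.

WHY (cell `pub/bsd-print-x9`, shared μ-crux `MuInequalityCoherentPair{OfHoward,OfPrint}`, STUB B `stub_controlGlue`, DISCRETE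
half, seat `bsd-line-x10b-p1-w2` g10, claim (DG2)). `DVRSetting.Conclusion hy one` (the typed conclusion of the cite-only
`thm161_dvrKolyvaginBound`) delivers an ADDITIVE bijection `Φ : H¹_F(K, A) ≃+ FracModR R × (M × M)` and the equivariance clause
`Φ [r • c] = r • Φ [c]` for level classes with `[c], [r • c] ∈ H¹_F(K, A)`. The glue
`…HeegnerMuPartStabilized.nonempty_specWitness_of_dvrConclusion{_one}` (p643969/p653022) wants an HONEST `R`-module `𝒜` with an
`R`-LINEAR `e𝒜 : 𝒜 ≃ FracModR R × (M × M)`. Take `𝒜 := FracModR R × (M × M)` itself (`e𝒜 := LinearEquiv.refl`); what must then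
be supplied to the discrete control map is the comparison `j := Φ⁻¹ : 𝒜 → H¹_F(K, A) ⊂ H¹(K, A)` and its `R`-SEMILINEARITY for the
levelwise action `r ↦ DirectLimit.map (H¹(r •))` on `H¹(K, A)`. This file proves it from the clause and the `R`-stability of
`H¹_F(K, A)` (`DVRSetting.of_scalarMapH1_mem_selmerA`, which discharges the clause's second membership hypothesis):

* `DVRSetting.coe_symm_smul_apply_mk_of` — `Φ⁻¹ (r • Φ [c]) = [r • c]` on representatives;
* `DVRSetting.coe_symm_smul_apply` — `Φ⁻¹ (r • Φ a) = r ⋆ a` for every `a ∈ H¹_F(K, A)` (`⋆` = `DirectLimit.map (H¹(r •))`);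
* **`DVRSetting.coe_symm_smul`** — `Φ⁻¹ (r • y) = r ⋆ Φ⁻¹ y` for every `y : FracModR R × (M × M)` (any `R`-module `P` in fact);
* **`DVRSetting.Conclusion.exists_semilinear`** — the conclusion of Thm. 1.6.1 REPACKAGED: the generator `x` of the free
  rank-one `H¹_F(K, T)`, the finite `M`, the additive `Φ` now with the two semilinearity statements above, and the printed bound
  `one = r₁ • x → len M ≤ len (R ⧸ r₁ R)` — for ANY proofs `hπ`, `he` (proof irrelevance), so that consumers need not
  reproduce the `let`-bound ones of `DVRSetting.Conclusion`.

References: [Howard2004HeegnerKolyvagin] B. Howard, Compositio Math. 140 (2004), Thm. 1.6.1 (arXiv:1202.6340 Thm. 2.6.1, p. 11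
L17–28; proof p. 12 L29–55: the `R`-module structures are the functorial ones); [SerreGaloisCohomology1997] I §2.2.
BSD is not proved by any of this.
-/

set_option autoImplicit false

noncomputable section

open Function NumberField IsDedekindDomain Field
open scoped NumberField ContRepresentation

namespace Literature.NumberTheory.GaloisCohomology.Howard2004

open Literature.NumberTheory.GaloisRepresentations
open Literature.NumberTheory.GaloisRepresentations.DiscreteGaloisModule
open Literature.NumberTheory.GaloisRepresentations.galoisCohomology

namespace DVRSetting

variable {p : ℕ} [Fact p.Prime] {K : Type} [Field K] [NumberField K]
  {R : Type} [CommRing R] [IsDomain R] [IsDiscreteValuationRing R] [Algebra ℤ_[p] R]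
  {N : ℕ → Type} [∀ k, AddCommGroup (N k)] [∀ k, TopologicalSpace (N k)] [∀ k, DiscreteTopology (N k)]
  [∀ k, Module R (N k)]
  {Rk : ℕ → Type} [∀ k, CommRing (Rk k)] [∀ k, IsLocalRing (Rk k)] [∀ k, TopologicalSpace (Rk k)]
  [∀ k, DiscreteTopology (Rk k)] [∀ k, Algebra ℤ_[p] (Rk k)] [∀ k, Algebra R (Rk k)]
  [∀ k, Module (Rk k) (N k)] [∀ k, IsScalarTower R (Rk k) (N k)]
  {Nbar : Type} [AddCommGroup Nbar] [TopologicalSpace Nbar] [DiscreteTopology Nbar] [∀ k, Module (Rk k) Nbar]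
  {Nq : ℕ → Finset (HeightOneSpectrum (𝓞 K)) → Type} [∀ k n, AddCommGroup (Nq k n)]
  [∀ k n, TopologicalSpace (Nq k n)] [∀ k n, DiscreteTopology (Nq k n)] [∀ k n, Module (Rk k) (Nq k n)]
  [∀ k n, Module R (Nq k n)] [∀ k n, IsScalarTower R (Rk k) (Nq k n)]
  (S : DVRSetting p K R N Rk Nbar Nq) (hy : S.SatisfiesH)
  (hπ : S.π ∈ IsLocalRing.maximalIdeal R) (he : ∀ k, S.e k ≤ S.e (k + 1))
  {P : Type} [AddCommGroup P] [Module R P]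
  (Φ : ↥(S.T.selmerA S.π S.e hy.killed hy.ker_red hπ he fun k => (S.t k).cond) ≃+ P)
  (hΦ : ∀ (j : ℕ) (r : R) (c : galoisCohomology (S.T.ρ j) 1)
    (hc : AddCommGroup.DirectLimit.of (fun k => galoisCohomology (S.T.ρ k) 1)
        (AdicTower.incH1LE S.T S.π S.e hy.killed hy.ker_red hπ he) j c ∈
      S.T.selmerA S.π S.e hy.killed hy.ker_red hπ he fun k => (S.t k).cond)
    (hrc : AddCommGroup.DirectLimit.of (fun k => galoisCohomology (S.T.ρ k) 1)
        (AdicTower.incH1LE S.T S.π S.e hy.killed hy.ker_red hπ he) j (scalarMapH1 _ (S.T.hlin j) r c) ∈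
      S.T.selmerA S.π S.e hy.killed hy.ker_red hπ he fun k => (S.t k).cond),
    Φ ⟨_, hrc⟩ = r • Φ ⟨_, hc⟩)

/-! ## §1 `Φ⁻¹` is `R`-semilinear -/

include hΦ in
/-- **`Φ⁻¹ (r • Φ [c]) = [r • c]`** on representatives (`[·] = DirectLimit.of _ _ j`; the second membership of the clause is
discharged by `of_scalarMapH1_mem_selmerA`). [cite: Howard2004HeegnerKolyvagin, Thm. 1.6.1 (arXiv p. 11 L17–28, p. 12 L29–55)] -/
theorem coe_symm_smul_apply_mk_of (j : ℕ) (r : R) (c : galoisCohomology (S.T.ρ j) 1)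
    (hc : AddCommGroup.DirectLimit.of (fun k => galoisCohomology (S.T.ρ k) 1)
        (AdicTower.incH1LE S.T S.π S.e hy.killed hy.ker_red hπ he) j c ∈
      S.T.selmerA S.π S.e hy.killed hy.ker_red hπ he fun k => (S.t k).cond) :
    ((Φ.symm (r • Φ ⟨_, hc⟩) : ↥(S.T.selmerA S.π S.e hy.killed hy.ker_red hπ he fun k => (S.t k).cond)) :
        AdicTower.H1A S.T S.π S.e hy.killed hy.ker_red hπ he) =
      AddCommGroup.DirectLimit.of (fun k => galoisCohomology (S.T.ρ k) 1)
        (AdicTower.incH1LE S.T S.π S.e hy.killed hy.ker_red hπ he) j (scalarMapH1 _ (S.T.hlin j) r c) := by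
  rw [← hΦ j r c hc (of_scalarMapH1_mem_selmerA S hy hπ he j r c hc), AddEquiv.symm_apply_apply]

include hΦ in
/-- **`Φ⁻¹ (r • Φ a) = r ⋆ a`** for `a ∈ H¹_F(K, A)`, `⋆` the levelwise action `DirectLimit.map (H¹(r •))` on `H¹(K, A)`.
[cite: Howard2004HeegnerKolyvagin, Thm. 1.6.1 (arXiv p. 11 L17–28, p. 12 L29–55)] -/
theorem coe_symm_smul_apply (r : R) (a : ↥(S.T.selmerA S.π S.e hy.killed hy.ker_red hπ he fun k => (S.t k).cond)) :
    ((Φ.symm (r • Φ a) : ↥(S.T.selmerA S.π S.e hy.killed hy.ker_red hπ he fun k => (S.t k).cond)) :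
        AdicTower.H1A S.T S.π S.e hy.killed hy.ker_red hπ he) =
      (AddCommGroup.DirectLimit.map (fun k => scalarMapH1 (S.T.ρ k) (S.T.hlin k) r)
        (AdicTower.scalarMapH1_comp_incH1LE S.T S.π S.e hy.killed hy.ker_red hπ he r)
        (a : AdicTower.H1A S.T S.π S.e hy.killed hy.ker_red hπ he) :
        AdicTower.H1A S.T S.π S.e hy.killed hy.ker_red hπ he) := by
  obtain ⟨j, c, hjc⟩ := AdicTower.exists_of_eq S.T S.π S.e hy.killed hy.ker_red hπ he
    (a : AdicTower.H1A S.T S.π S.e hy.killed hy.ker_red hπ he)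
  have hc : AddCommGroup.DirectLimit.of (fun k => galoisCohomology (S.T.ρ k) 1)
      (AdicTower.incH1LE S.T S.π S.e hy.killed hy.ker_red hπ he) j c ∈
      S.T.selmerA S.π S.e hy.killed hy.ker_red hπ he fun k => (S.t k).cond := hjc ▸ a.2
  have ha : a = ⟨_, hc⟩ := Subtype.ext hjc.symm
  subst ha
  rw [coe_symm_smul_apply_mk_of S hy hπ he Φ hΦ j r c hc]
  change _ = (AddCommGroup.DirectLimit.map (fun k => scalarMapH1 (S.T.ρ k) (S.T.hlin k) r)
    (AdicTower.scalarMapH1_comp_incH1LE S.T S.π S.e hy.killed hy.ker_red hπ he r)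
    (AddCommGroup.DirectLimit.of (fun k => galoisCohomology (S.T.ρ k) 1)
      (AdicTower.incH1LE S.T S.π S.e hy.killed hy.ker_red hπ he) j c) :
        AdicTower.H1A S.T S.π S.e hy.killed hy.ker_red hπ he)
  rw [AdicTower.map_scalarMapH1_of]

include hΦ in
/-- **`Φ⁻¹ (r • y) = r ⋆ Φ⁻¹ y` for every `y`**: the comparison `Φ⁻¹ : P → H¹_F(K, A) ⊂ H¹(K, A)` from the honest `R`-module
`P` (`= FracModR R × (M × M)` in Thm. 1.6.1) is `R`-SEMILINEAR for the levelwise action. [cite: Howard2004HeegnerKolyvagin, Thm. 1.6.1 (arXiv p. 11 L17–28, p. 12 L29–55)] -/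
theorem coe_symm_smul (r : R) (y : P) :
    ((Φ.symm (r • y) : ↥(S.T.selmerA S.π S.e hy.killed hy.ker_red hπ he fun k => (S.t k).cond)) :
        AdicTower.H1A S.T S.π S.e hy.killed hy.ker_red hπ he) =
      (AddCommGroup.DirectLimit.map (fun k => scalarMapH1 (S.T.ρ k) (S.T.hlin k) r)
        (AdicTower.scalarMapH1_comp_incH1LE S.T S.π S.e hy.killed hy.ker_red hπ he r)
        ((Φ.symm y : ↥(S.T.selmerA S.π S.e hy.killed hy.ker_red hπ he fun k => (S.t k).cond)) :
          AdicTower.H1A S.T S.π S.e hy.killed hy.ker_red hπ he) :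
        AdicTower.H1A S.T S.π S.e hy.killed hy.ker_red hπ he) := by
  conv_lhs => rw [← Φ.apply_symm_apply y]
  exact coe_symm_smul_apply S hy hπ he Φ hΦ r (Φ.symm y)

include hΦ in
/-- `Φ⁻¹ y` is represented at some level, and then `Φ⁻¹ (r • y) = [r • c]` for the same representative `c`.
[cite: Howard2004HeegnerKolyvagin, Thm. 1.6.1 (arXiv p. 11 L17–28, p. 12 L29–55)] -/
theorem exists_of_eq_coe_symm_and_smul (y : P) :
    ∃ (j : ℕ) (c : galoisCohomology (S.T.ρ j) 1),
      AddCommGroup.DirectLimit.of (fun k => galoisCohomology (S.T.ρ k) 1)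
          (AdicTower.incH1LE S.T S.π S.e hy.killed hy.ker_red hπ he) j c =
        ((Φ.symm y : ↥(S.T.selmerA S.π S.e hy.killed hy.ker_red hπ he fun k => (S.t k).cond)) :
          AdicTower.H1A S.T S.π S.e hy.killed hy.ker_red hπ he) ∧
      ∀ r : R, ((Φ.symm (r • y) : ↥(S.T.selmerA S.π S.e hy.killed hy.ker_red hπ he fun k => (S.t k).cond)) :
          AdicTower.H1A S.T S.π S.e hy.killed hy.ker_red hπ he) =
        AddCommGroup.DirectLimit.of (fun k => galoisCohomology (S.T.ρ k) 1)
          (AdicTower.incH1LE S.T S.π S.e hy.killed hy.ker_red hπ he) j (scalarMapH1 _ (S.T.hlin j) r c) := by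
  obtain ⟨j, c, hjc⟩ := AdicTower.exists_of_eq S.T S.π S.e hy.killed hy.ker_red hπ he
    ((Φ.symm y : ↥(S.T.selmerA S.π S.e hy.killed hy.ker_red hπ he fun k => (S.t k).cond)) :
      AdicTower.H1A S.T S.π S.e hy.killed hy.ker_red hπ he)
  refine ⟨j, c, hjc, fun r => ?_⟩
  rw [coe_symm_smul S hy hπ he Φ hΦ r y, ← hjc, AdicTower.map_scalarMapH1_of]

/-! ## §2 The conclusion of Theorem 1.6.1, repackaged -/

omit Φ hΦ

/-- **Howard's Thm. 1.6.1 conclusion with `Φ` `R`-semilinear** (for ANY proofs `hπ`, `he`): from `S.Conclusion hy one`, the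
generator `x` of the free rank-one `H¹_F(K, T)`, a finite `R`-module `M`, the additive bijection
`Φ : H¹_F(K, A) ≃ FracModR R × (M × M)` with `Φ⁻¹ (r • y) = r ⋆ Φ⁻¹ y` and `Φ⁻¹ (r • Φ [c]) = [r • c]`, and the bound
`one = r₁ • x → len_R M ≤ len_R (R ⧸ r₁R)`. [cite: Howard2004HeegnerKolyvagin, Thm. 1.6.1 (arXiv Thm. 2.6.1, p. 11 L17–28; proof p. 12 L29–55)] -/
theorem Conclusion.exists_semilinear {one : ∀ k, galoisCohomology (S.T.ρ k) 1} (h : S.Conclusion hy one) :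
    ∃ x : ∀ k, galoisCohomology (S.T.ρ k) 1,
      S.T.IsFreeRankOneOn (S.T.limitSelmer fun k => (S.t k).cond) x ∧
      ∃ (M : Type) (_ : AddCommGroup M) (_ : Module R M) (_ : Finite M)
        (Φ : ↥(S.T.selmerA S.π S.e hy.killed hy.ker_red hπ he fun k => (S.t k).cond) ≃+ (FracModR R × (M × M))),
        (∀ (r : R) (y : FracModR R × (M × M)),
          ((Φ.symm (r • y) : ↥(S.T.selmerA S.π S.e hy.killed hy.ker_red hπ he fun k => (S.t k).cond)) :
              AdicTower.H1A S.T S.π S.e hy.killed hy.ker_red hπ he) =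
            (AddCommGroup.DirectLimit.map (fun k => scalarMapH1 (S.T.ρ k) (S.T.hlin k) r)
              (AdicTower.scalarMapH1_comp_incH1LE S.T S.π S.e hy.killed hy.ker_red hπ he r)
              ((Φ.symm y : ↥(S.T.selmerA S.π S.e hy.killed hy.ker_red hπ he fun k => (S.t k).cond)) :
                AdicTower.H1A S.T S.π S.e hy.killed hy.ker_red hπ he) :
              AdicTower.H1A S.T S.π S.e hy.killed hy.ker_red hπ he)) ∧
        (∀ (j : ℕ) (r : R) (c : galoisCohomology (S.T.ρ j) 1)
          (hc : AddCommGroup.DirectLimit.of (fun k => galoisCohomology (S.T.ρ k) 1)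
              (AdicTower.incH1LE S.T S.π S.e hy.killed hy.ker_red hπ he) j c ∈
            S.T.selmerA S.π S.e hy.killed hy.ker_red hπ he fun k => (S.t k).cond),
          ((Φ.symm (r • Φ ⟨_, hc⟩) : ↥(S.T.selmerA S.π S.e hy.killed hy.ker_red hπ he fun k => (S.t k).cond)) :
              AdicTower.H1A S.T S.π S.e hy.killed hy.ker_red hπ he) =
            AddCommGroup.DirectLimit.of (fun k => galoisCohomology (S.T.ρ k) 1)
              (AdicTower.incH1LE S.T S.π S.e hy.killed hy.ker_red hπ he) j (scalarMapH1 _ (S.T.hlin j) r c)) ∧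
        ∀ r₁ : R, one = S.T.smulFamily r₁ x → Module.length R M ≤ Module.length R (R ⧸ Ideal.span {r₁}) := by
  obtain ⟨x, hfree, M, i₁, i₂, i₃, Φ, hΦ, hbound⟩ := h
  exact ⟨x, hfree, M, i₁, i₂, i₃, Φ, fun r y => coe_symm_smul S hy hπ he Φ hΦ r y,
    fun j r c hc => coe_symm_smul_apply_mk_of S hy hπ he Φ hΦ j r c hc, hbound⟩

end DVRSetting

end Literature.NumberTheory.GaloisCohomology.Howard2004

end
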